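import Summits.BirchSwinnertonDyer.BirchSwinnertonDyer.Theorems.PrintCFramBottomClassIndexLawFiveLeGenusInternalHeegnerSevenIndex
import HarnessLib

set_option linter.dupNamespace false -- namespace `…BirchSwinnertonDyer.BirchSwinnertonDyer…` is the cell's (D-0017 nested layout)
set_option autoImplicit false

/-!
# Crux `PrintCFram.BottomClassIndexLawFiveLe` (stmt-BirchSwinnertonDyer-20372), line `eisenstein-resource-bdp-line` (registry v25):
# THE GENUS-INTERNAL HEEGNER FIELD AT `p = 7`, file 3 — LEVEL-`49` TWINS of file 2's readings, in the binder shapes of the crux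
# workfile's P2 predicate `IndexIdentityAtCm7SevenOfLogUnit` (ideator bsd-idea-7 g20, `Cruxes/BottomClassIndexLawFiveLe/GenusInternalHeegnerFields.lean`)
# (cell `bsd-print-cfram`, width seat `bsd-line-cfram-p1-w6` g8; THEOREMS ONLY, `--supports` 20372; BSD is not proved by any of this)

HONEST FRAMING. Nothing here is a statement about BSD; no registered stub is closed; the registry is unchanged. File 2
(`…GenusInternalHeegnerSevenIndex`, p703056) states its `X₀(49)` readings with the parametrisation datum at level `cm7.conductorNorm ℤ`
(the level at which `KrizLi2019.thm120_padicLogHeegner_unit_of_bernoulli` is typed). The branch's consumers (the P2 predicate, bsd-eis's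
display at `(W, p, N) = (cm7, 7, 49)`) hold `Dt : ModularParametrizationData cm7 N` with `N = 49`, `H : HeegnerDatum N d_K`,
`SatisfiesHeegnerHypothesis 49 K` and `¬ (7 : ℤ) ∣ c(Dt)`. This file transports (`N = 49 = N(X₀(49))` by `subst`, `conductorNorm_cm7`):
`not_norm_nsCountLog_le_heegnerPoint_cm7_of_regular_level` (Thm. 1.20's conclusion from regularity), `padicLogOrd_heegnerPoint_cm7_eq_zero_of_regular_level`,
`not_exists_zsmul_eq_heegnerPoint_cm7_of_regular_level` (`(7 : ℤ) • Q` spelling), `padicValNat_index_heegnerPoint_cm7_eq_zero_of_regular_level`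
(`7 ∤ [X₀(49)(K) : ℤP]` — the unit-log input of the P2 predicate DISCHARGED from regularity in its own binder shapes). beyond-print theorem: NO.

References: [KrizLi2019] Thm. 1.20, Rem. 1.17, Rem. 1.21, §10.3; [GrossLMS1991] §2 (2.2); [Castella2018] §2.2; [SilvermanAEC2009] IV.6.4, VII.6.3.
-/

noncomputable section

open scoped Classical

open WeierstrassCurve NumberField DirichletCharacter
open Literature.NumberTheory Literature.NumberTheory.EllipticCurves
  Literature.NumberTheory.EllipticCurves.ModularForms
open Literature.NumberTheory.EllipticCurves.KrizLi2019 Literature.NumberTheory.LFunctions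
open Summit.BirchSwinnertonDyer.Rank1Residual
open Summit.BirchSwinnertonDyer.Rank1Residual.X12.O11.RouteU
open Summit.BirchSwinnertonDyer.BirchSwinnertonDyer.Theorems.GoldfeldGoodTwists

namespace Summit.BirchSwinnertonDyer.BirchSwinnertonDyer.Theorems.PrintCFram.GenusInternal

/-! ## Level-`49` twins -/

/-- **Kriz–Li's conclusion at `(X₀(49), 7, ψ = ω²)`, LEVEL-`N` datum with `N = 49`** (the shape of the crux workfile's P2 predicate
`IndexIdentityAtCm7SevenOfLogUnit`): for `K` imaginary quadratic with the Heegner hypothesis for `49`, `ε_K` Kronecker, `χ` primitive of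
level `m ⊥ 7` agreeing with `ε_K` off a finite set, `7 ∤ B_{5,χ}/5`; `Dt : ModularParametrizationData cm7 N`, `H : HeegnerDatum N d_K` with
`N = 49`, `ι`, `ιp`, `P` with `ι(P) = heegnerPointComplex Dt H`: `¬ ‖(|Ẽ^{ns}(𝔽₇)|/7)·log_{ω_𝓔} P/c(Dt)‖₇ ≤ 7⁻¹`, granted Thm. 1.20
(transport `N = 49 = N(X₀(49))` by `subst`, then §2). [cite: KrizLi2019, Thm. 1.20 (pp. 7–8) = Thm. 7.1, Rem. 1.21 (p. 8)] -/
theorem not_norm_nsCountLog_le_heegnerPoint_cm7_of_regular_level (h120 : thm120_padicLogHeegner_unit_of_bernoulli)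
    (K : Type) [Field K] [NumberField K] (hK : IsImaginaryQuadratic K) (hH : SatisfiesHeegnerHypothesis 49 K)
    (εK : DirichletCharacter ℚ_[7] (NumberField.discr K).natAbs) (hεK : IsKroneckerCharacterOf K εK)
    {m : ℕ} [NeZero m] (χ : DirichletCharacter ℚ_[7] m) (hχ : χ.IsPrimitive) (hm7 : m.Coprime 7) {N₀ : ℕ} (hN₀ : N₀ ≠ 0)
    (hχε : ∀ ℓ : ℕ, ℓ.Prime → ¬ ℓ ∣ N₀ → χ (ℓ : ZMod m) = εK (ℓ : ZMod (NumberField.discr K).natAbs))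
    (hreg : ¬ ‖(5 : ℚ_[7])⁻¹ * generalizedBernoulli 5 χ‖ ≤ (7 : ℝ)⁻¹)
    {N : ℕ} [NeZero N] (hN : N = 49) (Dt : ModularParametrizationData cm7 N)
    (H : HeegnerDatum N (NumberField.discr K)) (ι : K →+* ℂ) (ιp : K →+* ℚ_[7])
    (P : (cm7.baseChange K).toAffine.Point)
    (hPH : WeierstrassCurve.Affine.Point.map ι.toRatAlgHom P = heegnerPointComplex Dt H) :
    ¬ ‖((nsPointCount cm7 7 : ℤ) : ℚ_[7]) / ((7 : ℕ) : ℚ_[7]) *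
        (Castella2018.padicLogOmega cm7 7 ιp P / (Dt.maninConstant : ℚ_[7]))‖ ≤ ((7 : ℕ) : ℝ)⁻¹ := by
  have e : N = cm7.conductorNorm ℤ := hN.trans conductorNorm_cm7.symm
  subst e
  have hH' : SatisfiesHeegnerHypothesis (cm7.conductorNorm ℤ) K := by rw [conductorNorm_cm7]; exact hH
  exact not_norm_nsCountLog_le_heegnerPoint_cm7_of_regular h120 K hK hH' εK hεK χ hχ hm7 hN₀ hχε hreg Dt H ι ιp P hPH

/-- **`ord₇ log_{ω_𝓔} P_K = 0`, level-`N` datum with `N = 49`, `7 ∤ c(Dt)`** (§2 `padicLogOrd_heegnerPoint_cm7_eq_zero_of_regular` transported).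
[cite: KrizLi2019, Thm. 1.20 (p. 8), Rem. 1.17 (p. 6), §10.3] [cite: Castella2018, §2.2] -/
theorem padicLogOrd_heegnerPoint_cm7_eq_zero_of_regular_level (h120 : thm120_padicLogHeegner_unit_of_bernoulli)
    (K : Type) [Field K] [NumberField K] (hK : IsImaginaryQuadratic K) (hH : SatisfiesHeegnerHypothesis 49 K)
    (εK : DirichletCharacter ℚ_[7] (NumberField.discr K).natAbs) (hεK : IsKroneckerCharacterOf K εK)
    {m : ℕ} [NeZero m] (χ : DirichletCharacter ℚ_[7] m) (hχ : χ.IsPrimitive) (hm7 : m.Coprime 7) {N₀ : ℕ} (hN₀ : N₀ ≠ 0)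
    (hχε : ∀ ℓ : ℕ, ℓ.Prime → ¬ ℓ ∣ N₀ → χ (ℓ : ZMod m) = εK (ℓ : ZMod (NumberField.discr K).natAbs))
    (hreg : ¬ ‖(5 : ℚ_[7])⁻¹ * generalizedBernoulli 5 χ‖ ≤ (7 : ℝ)⁻¹)
    {N : ℕ} [NeZero N] (hN : N = 49) (Dt : ModularParametrizationData cm7 N)
    (H : HeegnerDatum N (NumberField.discr K)) (ι : K →+* ℂ) (ιp : K →+* ℚ_[7])
    (P : (cm7.baseChange K).toAffine.Point)
    (hPH : WeierstrassCurve.Affine.Point.map ι.toRatAlgHom P = heegnerPointComplex Dt H)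
    (hc : ¬ (7 : ℤ) ∣ Dt.maninConstant) :
    padicLogOrd cm7 7 ιp P = 0 := by
  have hc' : ¬ ((7 : ℕ) : ℤ) ∣ Dt.maninConstant := by exact_mod_cast hc
  exact padicLogOrd_eq_zero_of_not_le_inv_of_addv cm7 7 ιp P addv_cm7_seven (by norm_num) hc'
    (not_norm_nsCountLog_le_heegnerPoint_cm7_of_regular_level h120 K hK hH εK hεK χ hχ hm7 hN₀ hχε hreg hN Dt H ι ιp P hPH)

/-- **`P_K ∉ 7·X₀(49)(K)` with the `(7 : ℤ) •` spelling, level-`N` datum with `N = 49`, `7 ∤ c(Dt)`** (§2 transported).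
[cite: KrizLi2019, Thm. 1.20 (p. 8), (29) (pp. 49–50)] [cite: SilvermanAEC2009, IV.6.4 and VII.6.3] -/
theorem not_exists_zsmul_eq_heegnerPoint_cm7_of_regular_level (h120 : thm120_padicLogHeegner_unit_of_bernoulli)
    (K : Type) [Field K] [NumberField K] (hK : IsImaginaryQuadratic K) (hH : SatisfiesHeegnerHypothesis 49 K)
    (εK : DirichletCharacter ℚ_[7] (NumberField.discr K).natAbs) (hεK : IsKroneckerCharacterOf K εK)
    {m : ℕ} [NeZero m] (χ : DirichletCharacter ℚ_[7] m) (hχ : χ.IsPrimitive) (hm7 : m.Coprime 7) {N₀ : ℕ} (hN₀ : N₀ ≠ 0)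
    (hχε : ∀ ℓ : ℕ, ℓ.Prime → ¬ ℓ ∣ N₀ → χ (ℓ : ZMod m) = εK (ℓ : ZMod (NumberField.discr K).natAbs))
    (hreg : ¬ ‖(5 : ℚ_[7])⁻¹ * generalizedBernoulli 5 χ‖ ≤ (7 : ℝ)⁻¹)
    {N : ℕ} [NeZero N] (hN : N = 49) (Dt : ModularParametrizationData cm7 N)
    (H : HeegnerDatum N (NumberField.discr K)) (ι : K →+* ℂ) (ιp : K →+* ℚ_[7])
    (P : (cm7.baseChange K).toAffine.Point)
    (hPH : WeierstrassCurve.Affine.Point.map ι.toRatAlgHom P = heegnerPointComplex Dt H)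
    (hc : ¬ (7 : ℤ) ∣ Dt.maninConstant) :
    ¬ ∃ Q : (cm7.baseChange K).toAffine.Point, (7 : ℤ) • Q = P := by
  have hc' : ¬ ((7 : ℕ) : ℤ) ∣ Dt.maninConstant := by exact_mod_cast hc
  exact not_exists_zsmul_eq_of_not_le_inv_of_addv cm7 7 ιp P addv_cm7_seven (by norm_num) hc'
    (not_norm_nsCountLog_le_heegnerPoint_cm7_of_regular_level h120 K hK hH εK hεK χ hχ hm7 hN₀ hχε hreg hN Dt H ι ιp P hPH)

/-- **`7 ∤ [X₀(49)(K) : ℤP_K]`, level-`N` datum with `N = 49`, `7 ∤ c(Dt)`** (§2 headline transported): the right-hand side of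
`X11b.IndexIdentityAt cm7 7 K P` vanishes — the unit-log input of the crux workfile's P2 predicate `IndexIdentityAtCm7SevenOfLogUnit`
DISCHARGED from regularity, in that predicate's binder shapes. [cite: KrizLi2019, Thm. 1.20 (pp. 7–8), §10.3] [cite: GrossLMS1991, §2 Conj. (2.2)] -/
theorem padicValNat_index_heegnerPoint_cm7_eq_zero_of_regular_level (h120 : thm120_padicLogHeegner_unit_of_bernoulli)
    (K : Type) [Field K] [NumberField K] (hK : IsImaginaryQuadratic K) (hH : SatisfiesHeegnerHypothesis 49 K)
    (εK : DirichletCharacter ℚ_[7] (NumberField.discr K).natAbs) (hεK : IsKroneckerCharacterOf K εK)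
    {m : ℕ} [NeZero m] (χ : DirichletCharacter ℚ_[7] m) (hχ : χ.IsPrimitive) (hm7 : m.Coprime 7) {N₀ : ℕ} (hN₀ : N₀ ≠ 0)
    (hχε : ∀ ℓ : ℕ, ℓ.Prime → ¬ ℓ ∣ N₀ → χ (ℓ : ZMod m) = εK (ℓ : ZMod (NumberField.discr K).natAbs))
    (hreg : ¬ ‖(5 : ℚ_[7])⁻¹ * generalizedBernoulli 5 χ‖ ≤ (7 : ℝ)⁻¹)
    {N : ℕ} [NeZero N] (hN : N = 49) (Dt : ModularParametrizationData cm7 N)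
    (H : HeegnerDatum N (NumberField.discr K)) (ι : K →+* ℂ) (ιp : K →+* ℚ_[7])
    (P : (cm7.baseChange K).toAffine.Point)
    (hPH : WeierstrassCurve.Affine.Point.map ι.toRatAlgHom P = heegnerPointComplex Dt H)
    (hc : ¬ (7 : ℤ) ∣ Dt.maninConstant) :
    padicValNat 7 (AddSubgroup.zmultiples P).index = 0 := by
  have hc' : ¬ ((7 : ℕ) : ℤ) ∣ Dt.maninConstant := by exact_mod_cast hc
  exact padicValNat_index_eq_zero_of_not_le_inv_of_addv cm7 7 ιp P addv_cm7_seven (by norm_num) hc'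
    (noSevenTorsion_cm7_baseChange K ιp)
    (not_norm_nsCountLog_le_heegnerPoint_cm7_of_regular_level h120 K hK hH εK hεK χ hχ hm7 hN₀ hχε hreg hN Dt H ι ιp P hPH)


end Summit.BirchSwinnertonDyer.BirchSwinnertonDyer.Theorems.PrintCFram.GenusInternal

end
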